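import Summits.ValiantsHypothesis.ValiantsHypothesis.Theorems.SymPencilPerFourPeeledTwoPencilDesign
import Summits.ValiantsHypothesis.ValiantsHypothesis.Theorems.SymPencilPerFourInnerRankOfPeeled

/-!
# Route `SymPencil` — inner rank of the `2 | 2` row split of `per_4`: HR2(11) — hence IR11 and the
# cell `(8,8,11)` — REDUCED TO TWO-PENCIL FRAME EXISTENCE FOR `4 × 4` MATRICES
# (`--supports` stmt-ValiantsHypothesis-5674 `SdcSuperquadratic`; (8,8) column of the size tables,
# memo `NOTE-p8g15-5674-R2-two-pencil.md` §2/§7; rung currency only)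

**Theorem** (`false_of_peeled_of_frames`).  Suppose that for EVERY matrix `Ψ : K^{4×4}` there is a
two-pencil frame: vectors `a₀, a₁, y₀, y₁ ∈ K⁴` with `a_j ⬝ Ψ y_i = 0` (`i, j ∈ {0,1}`), the pure
permanent matrices `P_ij = [per(a_j; e_b; y_i; e_l)]`, a left inverse `W₀ P₀₀ = 1`, an eigenbasis of
the pencil `(P₀₀, P₁₀)` with pairwise distinct eigenvalues (`P₁₀ v_j = s_j P₀₀ v_j`, `W · of v = 1`)
and `Q = P₁₁ - P₁₀ W₀ P₀₁ ≠ 0` — a statement about `4 × 4` matrices over `K` only.  Then no reduced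
PEELED family (`…InnerRankReducedFamily.exists_reduced_family` data with non-zero correction) exists
on `≤ 11` squares.  Proof: the scalar outer block `t((a,0),(x,0)) = ψ(a,x) v₀` defines a bilinear
`ψ` (as `v₀ ≠ 0` in the peeled case) with matrix `Ψ`; the frame for `Ψ` satisfies
`t((a_j,0),(y_i,0)) = 0`, and `…PeeledTwoPencilDesign.false_of_frame` concludes.
Corollaries: `HR2_eleven_of_frames` (the `HR2` binder of `…InnerRankOfPeeled.IR_of_peeled` at
`d = 11`), `IR11_of_frames`, and `false_of_rank_eight_le_twentyEight_of_frames` (cell `(8,8,11)` of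
`m = 28` modulo frame existence).

What remains for `(8,8,11)` is therefore EXACTLY the frame-existence case analysis over
`Ψ ∈ K^{4×4}` (memo §4/§7: Σ₀ / Case-A / V recipes cover every tested class but the pure swap
`λ(E_ij + E_ji)`; files `…TwoPencilSigmaZero[General]`, `…TwoPencilTransport`, `…TwoPencilCaseA`).
Honest framing: conditional reduction; no cell closes here; the window of record, the crux
`SdcSuperquadratic` and `VP ≠ VNP` are untouched.  No definitions, no named facts. [folklore]
-/

noncomputable section

-- single-conjunct layout: Sub = Summit, duplicated namespace component intended
set_option linter.dupNamespace false

namespace Summit.ValiantsHypothesis.ValiantsHypothesis.Theorems.SymPencilPerFourPeeledTwoPencilReduction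

open Matrix Finset Module MvPolynomial
open Literature.Computability.AlgebraicComplexity
open Summit.ValiantsHypothesis.ValiantsHypothesis.Theorems.SymPencilPerFourPeeledTwoPencilDesign
open Summit.ValiantsHypothesis.ValiantsHypothesis.Theorems.SymPencilPerFourInnerRankOfPeeled

universe u v

variable {K : Type u} [Field K]

/-- **HR2(11) from two-pencil frame existence.**  See the module docstring. [folklore] -/
theorem false_of_peeled_of_frames [CharZero K]
    (hframes : ∀ Ψ : Matrix (Fin 4) (Fin 4) K,
      ∃ (a₀ a₁ y₀ y₁ : Fin 4 → K) (P₀₀ P₁₀ P₀₁ P₁₁ W₀ : Matrix (Fin 4) (Fin 4) K)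
        (v : Fin 4 → Fin 4 → K) (s : Fin 4 → K) (W : Matrix (Fin 4) (Fin 4) K),
        a₀ ⬝ᵥ Ψ *ᵥ y₀ = 0 ∧ a₀ ⬝ᵥ Ψ *ᵥ y₁ = 0 ∧ a₁ ⬝ᵥ Ψ *ᵥ y₀ = 0 ∧ a₁ ⬝ᵥ Ψ *ᵥ y₁ = 0 ∧
        (∀ b l, P₀₀ b l = (Matrix.of ![a₀, Pi.single b 1, y₀, Pi.single l 1]).permanent) ∧
        (∀ b l, P₁₀ b l = (Matrix.of ![a₀, Pi.single b 1, y₁, Pi.single l 1]).permanent) ∧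
        (∀ b l, P₀₁ b l = (Matrix.of ![a₁, Pi.single b 1, y₀, Pi.single l 1]).permanent) ∧
        (∀ b l, P₁₁ b l = (Matrix.of ![a₁, Pi.single b 1, y₁, Pi.single l 1]).permanent) ∧
        W₀ * P₀₀ = 1 ∧ (∀ j, P₁₀ *ᵥ v j = s j • P₀₀ *ᵥ v j) ∧ (∀ i j, i ≠ j → s i ≠ s j) ∧
        W * Matrix.of v = 1 ∧ P₁₁ - P₁₀ * W₀ * P₀₁ ≠ 0)
    {κ : Type v} [Fintype κ] [DecidableEq κ] (hκ : Fintype.card κ ≤ 11) (c : κ → K)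
    (t : κ → (((Fin 4 → K) × (Fin 4 → K)) →ₗ[K] ((Fin 4 → K) × (Fin 4 → K)) →ₗ[K] K))
    (hJ : ∀ a b y₂ y₃ : Fin 4 → K,
      ∑ r, c r * (t r (a, b) (y₂, y₃)) ^ 2 = (Matrix.of ![a, b, y₂, y₃]).permanent)
    (v₀ v₀' : κ → K) (hv₀ : ∀ (a x : Fin 4 → K), ∃ s : K, (fun r => t r (a, 0) (x, 0)) = s • v₀)
    (hv₀' : ∀ (b x : Fin 4 → K), ∃ s : K, (fun r => t r (0, b) (0, x)) = s • v₀')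
    (hpeel : ∃ a b y z : Fin 4 → K, ∑ r, c r * t r (a, 0) (y, 0) * t r (0, b) (0, z) ≠ 0) :
    False := by
  classical
  -- `v₀ ≠ 0` in the peeled case
  obtain ⟨a', b', yy, zz, hne⟩ := hpeel
  have hv₀ne : v₀ ≠ 0 := by
    intro h0
    apply hne
    obtain ⟨s, hs⟩ := hv₀ a' yy
    refine Finset.sum_eq_zero fun r _ => ?_
    have e : t r (a', 0) (yy, 0) = s * v₀ r := by have := congr_fun hs r; simpa using this
    rw [e, h0, Pi.zero_apply, mul_zero, mul_zero, zero_mul]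
  obtain ⟨r₀, hr₀⟩ : ∃ r, v₀ r ≠ 0 := by
    by_contra h
    push Not at h
    exact hv₀ne (funext h)
  -- the scalar `ψ(a,x)` and its bilinearity
  let ψ : (Fin 4 → K) → (Fin 4 → K) → K := fun a x => t r₀ (a, 0) (x, 0) / v₀ r₀
  have hψ : ∀ a x r, t r (a, 0) (x, 0) = ψ a x * v₀ r := by
    intro a x r
    obtain ⟨s, hs⟩ := hv₀ a x
    have e : ∀ r', t r' (a, 0) (x, 0) = s * v₀ r' := fun r' => by
      have := congr_fun hs r'; simpa using this
    have hs' : ψ a x = s := by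
      show t r₀ (a, 0) (x, 0) / v₀ r₀ = s
      rw [e r₀, mul_div_assoc, div_self hr₀, mul_one]
    rw [hs', e r]
  have hψ_add_left : ∀ a a' x, ψ (a + a') x = ψ a x + ψ a' x := by
    intro a a' x
    show t r₀ (a + a', 0) (x, 0) / v₀ r₀ = t r₀ (a, 0) (x, 0) / v₀ r₀ + t r₀ (a', 0) (x, 0) / v₀ r₀
    have : ((a + a', (0 : Fin 4 → K)) : (Fin 4 → K) × (Fin 4 → K)) = (a, 0) + (a', 0) := by simp
    rw [this, map_add, LinearMap.add_apply, add_div]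
  have hψ_smul_left : ∀ (μ : K) a x, ψ (μ • a) x = μ * ψ a x := by
    intro μ a x
    show t r₀ (μ • a, 0) (x, 0) / v₀ r₀ = μ * (t r₀ (a, 0) (x, 0) / v₀ r₀)
    have : ((μ • a, (0 : Fin 4 → K)) : (Fin 4 → K) × (Fin 4 → K)) = μ • (a, 0) := by simp
    rw [this, map_smul, LinearMap.smul_apply, smul_eq_mul, mul_div_assoc]
  have hψ_add_right : ∀ a x x', ψ a (x + x') = ψ a x + ψ a x' := by
    intro a x x'
    show t r₀ (a, 0) (x + x', 0) / v₀ r₀ = t r₀ (a, 0) (x, 0) / v₀ r₀ + t r₀ (a, 0) (x', 0) / v₀ r₀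
    have : ((x + x', (0 : Fin 4 → K)) : (Fin 4 → K) × (Fin 4 → K)) = (x, 0) + (x', 0) := by simp
    rw [this, map_add, add_div]
  have hψ_smul_right : ∀ (μ : K) a x, ψ a (μ • x) = μ * ψ a x := by
    intro μ a x
    show t r₀ (a, 0) (μ • x, 0) / v₀ r₀ = μ * (t r₀ (a, 0) (x, 0) / v₀ r₀)
    have : ((μ • x, (0 : Fin 4 → K)) : (Fin 4 → K) × (Fin 4 → K)) = μ • (x, 0) := by simp
    rw [this, map_smul, smul_eq_mul, mul_div_assoc]
  -- the matrix `Ψ` and the expansion `ψ a x = a ⬝ Ψ x`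
  let Ψ : Matrix (Fin 4) (Fin 4) K := Matrix.of fun i k => ψ (Pi.single i 1) (Pi.single k 1)
  have hexp : ∀ a x : Fin 4 → K, ψ a x = a ⬝ᵥ Ψ *ᵥ x := by
    intro a x
    have ha : a = ∑ i, a i • (Pi.single i (1 : K) : Fin 4 → K) := by
      funext k; simp [Finset.sum_apply, Pi.single_apply]
    have hx : x = ∑ k, x k • (Pi.single k (1 : K) : Fin 4 → K) := by
      funext k; simp [Finset.sum_apply, Pi.single_apply]
    -- expand in the first slot
    have hleft : ∀ (x : Fin 4 → K), ψ a x = ∑ i, a i * ψ (Pi.single i 1) x := by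
      intro x
      conv_lhs => rw [ha]
      have : ∀ (S : Finset (Fin 4)), ψ (∑ i ∈ S, a i • (Pi.single i (1 : K) : Fin 4 → K)) x =
          ∑ i ∈ S, a i * ψ (Pi.single i 1) x := by
        intro S
        induction S using Finset.induction_on with
        | empty =>
          simp only [Finset.sum_empty]
          have := hψ_smul_left 0 0 x
          rw [zero_smul, zero_mul] at this
          exact this
        | insert i S hi ih =>
          rw [Finset.sum_insert hi, Finset.sum_insert hi, hψ_add_left, hψ_smul_left, ih]
      exact this Finset.univ
    have hright : ∀ (i : Fin 4), ψ (Pi.single i 1) x = ∑ k, x k * ψ (Pi.single i 1) (Pi.single k 1) := by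
      intro i
      conv_lhs => rw [hx]
      have : ∀ (S : Finset (Fin 4)),
          ψ (Pi.single i 1) (∑ k ∈ S, x k • (Pi.single k (1 : K) : Fin 4 → K)) =
          ∑ k ∈ S, x k * ψ (Pi.single i 1) (Pi.single k 1) := by
        intro S
        induction S using Finset.induction_on with
        | empty =>
          simp only [Finset.sum_empty]
          have := hψ_smul_right 0 (Pi.single i 1) 0
          rw [zero_smul, zero_mul] at this
          exact this
        | insert k S hk ih =>
          rw [Finset.sum_insert hk, Finset.sum_insert hk, hψ_add_right, hψ_smul_right, ih]
      exact this Finset.univ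
    rw [hleft]
    simp only [hright, dotProduct, mulVec, Ψ, Matrix.of_apply, Finset.mul_sum]
    exact Finset.sum_congr rfl fun i _ => Finset.sum_congr rfl fun k _ => by ring
  -- the frame for `Ψ`
  obtain ⟨a₀, a₁, y₀, y₁, P₀₀, P₁₀, P₀₁, P₁₁, W₀, v, s, W, h00, h01, h10, h11, hP₀₀, hP₁₀, hP₀₁, hP₁₁,
    hW₀, hv, hs, hW, hQ⟩ := hframes Ψ
  have hzero : ∀ (a y : Fin 4 → K), a ⬝ᵥ Ψ *ᵥ y = 0 → ∀ r, t r (a, 0) (y, 0) = 0 := by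
    intro a y h r
    rw [hψ, hexp, h, zero_mul]
  exact false_of_frame hκ c t hJ v₀ v₀' hv₀ hv₀' ⟨a', b', yy, zz, hne⟩ a₀ a₁ y₀ y₁
    (hzero a₀ y₀ h00) (hzero a₀ y₁ h01) (hzero a₁ y₀ h10) (hzero a₁ y₁ h11)
    P₀₀ P₁₀ P₀₁ P₁₁ hP₀₀ hP₁₀ hP₀₁ hP₁₁ W₀ hW₀ v s hv hs W hW hQ


/-- **IR11 from two-pencil frame existence**: no eleven-square identity for the `2 | 2` split of
`per_4` (the hypothesis `IR11` of `…CellEightEight`), GIVEN a frame for every `Ψ`. [folklore] -/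
theorem IR11_of_frames [CharZero K]
    (hframes : ∀ Ψ : Matrix (Fin 4) (Fin 4) K,
      ∃ (a₀ a₁ y₀ y₁ : Fin 4 → K) (P₀₀ P₁₀ P₀₁ P₁₁ W₀ : Matrix (Fin 4) (Fin 4) K)
        (v : Fin 4 → Fin 4 → K) (s : Fin 4 → K) (W : Matrix (Fin 4) (Fin 4) K),
        a₀ ⬝ᵥ Ψ *ᵥ y₀ = 0 ∧ a₀ ⬝ᵥ Ψ *ᵥ y₁ = 0 ∧ a₁ ⬝ᵥ Ψ *ᵥ y₀ = 0 ∧ a₁ ⬝ᵥ Ψ *ᵥ y₁ = 0 ∧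
        (∀ b l, P₀₀ b l = (Matrix.of ![a₀, Pi.single b 1, y₀, Pi.single l 1]).permanent) ∧
        (∀ b l, P₁₀ b l = (Matrix.of ![a₀, Pi.single b 1, y₁, Pi.single l 1]).permanent) ∧
        (∀ b l, P₀₁ b l = (Matrix.of ![a₁, Pi.single b 1, y₀, Pi.single l 1]).permanent) ∧
        (∀ b l, P₁₁ b l = (Matrix.of ![a₁, Pi.single b 1, y₁, Pi.single l 1]).permanent) ∧
        W₀ * P₀₀ = 1 ∧ (∀ j, P₁₀ *ᵥ v j = s j • P₀₀ *ᵥ v j) ∧ (∀ i j, i ≠ j → s i ≠ s j) ∧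
        W * Matrix.of v = 1 ∧ P₁₁ - P₁₀ * W₀ * P₀₁ ≠ 0) :
    ∀ (c : Fin 11 → K)
      (t : Fin 11 → (((Fin 4 → K) × (Fin 4 → K)) →ₗ[K] ((Fin 4 → K) × (Fin 4 → K)) →ₗ[K] K)),
      ¬ ∀ a b y₂ y₃ : Fin 4 → K,
        ∑ r, c r * (t r (a, b) (y₂, y₃)) ^ 2 = (Matrix.of ![a, b, y₂, y₃]).permanent :=
  IR_of_peeled le_rfl fun _ _ _ hκ c _ t hJ v₀ v₀' hv₀ hv₀' _ hpeel =>
    false_of_peeled_of_frames hframes hκ c t hJ v₀ v₀' hv₀ hv₀' hpeel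

/-- **Cell `(8, 8, 11)` of `m = 28` is empty GIVEN a two-pencil frame for every `Ψ ∈ K^{4×4}`**
(`…InnerRankOfPeeled.false_of_rank_eight_le_twentyEight_of_peeled_eleven` fed by
`false_of_peeled_of_frames`). [folklore] -/
theorem false_of_rank_eight_le_twentyEight_of_frames (K : Type*) [Field K] [CharZero K]
    (hframes : ∀ Ψ : Matrix (Fin 4) (Fin 4) K,
      ∃ (a₀ a₁ y₀ y₁ : Fin 4 → K) (P₀₀ P₁₀ P₀₁ P₁₁ W₀ : Matrix (Fin 4) (Fin 4) K)
        (v : Fin 4 → Fin 4 → K) (s : Fin 4 → K) (W : Matrix (Fin 4) (Fin 4) K),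
        a₀ ⬝ᵥ Ψ *ᵥ y₀ = 0 ∧ a₀ ⬝ᵥ Ψ *ᵥ y₁ = 0 ∧ a₁ ⬝ᵥ Ψ *ᵥ y₀ = 0 ∧ a₁ ⬝ᵥ Ψ *ᵥ y₁ = 0 ∧
        (∀ b l, P₀₀ b l = (Matrix.of ![a₀, Pi.single b 1, y₀, Pi.single l 1]).permanent) ∧
        (∀ b l, P₁₀ b l = (Matrix.of ![a₀, Pi.single b 1, y₁, Pi.single l 1]).permanent) ∧
        (∀ b l, P₀₁ b l = (Matrix.of ![a₁, Pi.single b 1, y₀, Pi.single l 1]).permanent) ∧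
        (∀ b l, P₁₁ b l = (Matrix.of ![a₁, Pi.single b 1, y₁, Pi.single l 1]).permanent) ∧
        W₀ * P₀₀ = 1 ∧ (∀ j, P₁₀ *ᵥ v j = s j • P₀₀ *ᵥ v j) ∧ (∀ i j, i ≠ j → s i ≠ s j) ∧
        W * Matrix.of v = 1 ∧ P₁₁ - P₁₀ * W₀ * P₀₁ ≠ 0)
    {m : ℕ} (hm : m ≤ 28)
    {i₀ : Fin m} {D : Matrix {i // i ≠ i₀} {i // i ≠ i₀} K}
    {bL : (Fin 4 × Fin 4 → K) →ₗ[K] ({i // i ≠ i₀} → K)}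
    {CL : (Fin 4 × Fin 4 → K) →ₗ[K] Matrix {i // i ≠ i₀} {i // i ≠ i₀} K} {κ₀ : K}
    (hD : IsUnit D.det) (hDs : Dᵀ = D) (hCs : ∀ z, (CL z)ᵀ = CL z) (hκ₀ : κ₀ ≠ 0)
    (hi : ∀ z, bL z ⬝ᵥ D⁻¹ *ᵥ bL z = 0)
    (hii : ∀ z, bL z ⬝ᵥ (D⁻¹ * CL z * D⁻¹) *ᵥ bL z = 0)
    (hiii : ∀ z, D.det * (bL z ⬝ᵥ (D⁻¹ * CL z * D⁻¹ * CL z * D⁻¹) *ᵥ bL z) =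
      -(κ₀ * eval z (perPoly (Fin 4) K)))
    (hV4 : ∀ x ∈ LinearMap.ker bL, ∀ r c : Fin 4,
      ((Matrix.of fun i j => x (i, j)).submatrix r.succAbove c.succAbove).permanent = 0)
    (hcard : Fintype.card {i // i ≠ i₀} + 1 = m)
    (hrn : finrank K (LinearMap.range bL) + finrank K (LinearMap.ker bL) = 16)
    (h8 : finrank K (LinearMap.range bL) = 8) : False :=
  false_of_rank_eight_le_twentyEight_of_peeled_eleven K hm hD hDs hCs hκ₀ hi hii hiii hV4 hcard hrn
    (fun _ _ _ hκ c _ t hJ v₀ v₀' hv₀ hv₀' _ hpeel =>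
      false_of_peeled_of_frames hframes hκ c t hJ v₀ v₀' hv₀ hv₀' hpeel) h8

end Summit.ValiantsHypothesis.ValiantsHypothesis.Theorems.SymPencilPerFourPeeledTwoPencilReduction

end
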